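import Literature.Probability.Percolation.BoxArcStateReading
import Literature.Probability.Percolation.CrossingChains
import Literature.Probability.Percolation.FourArmGarbanSquareDomain
import Literature.Probability.LatticeModels.MeshDomainBulk
import Summits.CriticalPhenomena.CardyFormulaZ2.Theorems.CardyGluingRDEGluingContractionPsiCollapse
import Literature.Probability.Percolation.GluingRDE
import Literature.Probability.Percolation.MultiResTVSegments
import Literature.Probability.Percolation.PlanarDuality
import Literature.Probability.Percolation.RSWProofs
import Literature.Probability.Percolation.HalfPlaneArmAxisInputs
import Literature.Probability.Percolation.ZdNearCriticalWindow

/-!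
# `stub_shadowingZ` is false (crux `GluingContraction`, line birth), Part 1: ties, truth event

Deterministic lattice geometry for the refutation of the registered stub `stub_shadowingZ` of the
birth skeleton of crux `CardyGluingRDE.GluingContraction` (stmt-CriticalPhenomena-8580), about bond
percolation read in the open unit square `sq 1 = (0,1)²` at a mesh `1/N`:

* `tie_crossing` — the tie mechanism (the one that refuted `JunctionShadowing`, stmt-8581):
  `discreteArc` compares distances with `≤`, so a boundary vertex one row inside the window whose
  mesh point is within `1/N` of two boundary pieces lies in BOTH discrete arcs, and
  `discreteCrossing` between the two pieces holds for EVERY configuration by the trivial path.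
* `coord_of_mem_meshBoundary` — boundary vertices of the discretised open square have a
  coordinate in `{1, N-1}`; hence (`truth_subset`) the true crossing event "closed left side ↔
  closed right side" at mesh `1/N`, `N ≥ 3`, is contained in the left-right crossing of the
  lattice square `(1,1) + [0,N-2]²`.

Part 2 proves that every read state is primal-connected at commensurable meshes; the file
`…StubShadowingZFalse.lean` adds the probability estimates and the contradiction.
-/

namespace Summit.CriticalPhenomena.CardyFormulaZ2.Theorems

namespace StubShadowingZ

open Set Metric MeasureTheory Complex
open Literature.Probability.Percolation Literature.Probability.LatticeModels

/-! ### The open unit square and its discretisation at mesh `1/N` -/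

/-- The open axis-parallel rectangle `(a,b) × (c,d)`. [folklore] -/
def oRect (a b c d : ℝ) : Set ℂ := Ioo a b ×ℂ Ioo c d

/-- The reading window `sq 1` is the open unit square. [folklore] -/
theorem sq_one : Literature.Probability.Percolation.sq 1 = oRect 0 1 0 1 := by
  ext z
  simp only [Literature.Probability.Percolation.sq, oRect, mem_reProdIm, mem_setOf_eq, mem_Ioo]
  tauto

/-- Mesh vertices of an open rectangle, in coordinates. [folklore] -/
theorem mem_meshVertices_oRect {a b c d δ : ℝ} {x : Site 2} :
    x ∈ meshVertices (oRect a b c d) δ ↔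
      (a < δ * x 0 ∧ δ * x 0 < b) ∧ (c < δ * x 1 ∧ δ * x 1 < d) := by
  simp [oRect, mem_reProdIm]

/-- The rectangle spanned by two mesh vertices of an open rectangle stays inside it. [folklore] -/
theorem rectangle_subset_oRect {a b c d δ : ℝ} {x y : Site 2}
    (hx : x ∈ meshVertices (oRect a b c d) δ) (hy : y ∈ meshVertices (oRect a b c d) δ) :
    Rectangle (meshPoint δ x) (meshPoint δ y) ⊆ oRect a b c d := by
  intro z hz
  have hx' := mem_meshVertices_oRect.1 hx
  have hy' := mem_meshVertices_oRect.1 hy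
  rw [Rectangle, mem_reProdIm, meshPoint_re, meshPoint_re, meshPoint_im, meshPoint_im] at hz
  exact ⟨(ordConnected_Ioo.uIcc_subset ⟨hx'.1.1, hx'.1.2⟩ ⟨hy'.1.1, hy'.1.2⟩) hz.1,
    (ordConnected_Ioo.uIcc_subset ⟨hx'.2.1, hx'.2.2⟩ ⟨hy'.2.1, hy'.2.2⟩) hz.2⟩

/-- The mesh graph of an open rectangle is connected (staircase lemma), so the discrete domain is
the whole set of mesh vertices. [folklore] -/
theorem meshDomain_oRect (a b c d : ℝ) {δ : ℝ} (hδ : 0 < δ) :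
    meshDomain (oRect a b c d) δ = meshVertices (oRect a b c d) δ := by
  refine meshDomain_eq_meshVertices_of_preconnected ?_
  rintro ⟨x, hx⟩ ⟨y, hy⟩
  exact meshVertexGraph_reachable_of_rectangle_subset hδ _ x y rfl (rectangle_subset_oRect hx hy)
    hx hy

/-- Integer coordinates of the mesh vertices of the unit square at mesh `1/N`. [folklore] -/
theorem mem_meshVertices_unitSq {N : ℕ} (hN : 0 < N) {v : Site 2} :
    v ∈ meshVertices (oRect 0 1 0 1) (N : ℝ)⁻¹ ↔
      (0 < v 0 ∧ v 0 < (N : ℤ)) ∧ (0 < v 1 ∧ v 1 < (N : ℤ)) := by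
  have hN' : (0 : ℝ) < N := by exact_mod_cast hN
  have key : ∀ t : ℤ, (0 < (N : ℝ)⁻¹ * t ∧ (N : ℝ)⁻¹ * t < 1) ↔ (0 < t ∧ t < (N : ℤ)) := fun t => by
    rw [← div_eq_inv_mul, lt_div_iff₀ hN', div_lt_iff₀ hN', zero_mul, one_mul]
    exact ⟨fun h => ⟨by exact_mod_cast h.1, by exact_mod_cast h.2⟩,
      fun h => ⟨by exact_mod_cast h.1, by exact_mod_cast h.2⟩⟩
  rw [mem_meshVertices_oRect, key, key]

/-- **Boundary vertices of the discretised open unit square** at mesh `1/N` have a coordinate in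
`{1, N-1}`: every other `ℤ²`-neighbour of a vertex is a mesh vertex joined to it by a closed edge
inside the (convex) window. [folklore] -/
theorem coord_of_mem_meshBoundary {N : ℕ} (hN : 0 < N) {x : Site 2}
    (hx : x ∈ meshBoundary (oRect 0 1 0 1) (N : ℝ)⁻¹) :
    ((0 < x 0 ∧ x 0 < (N : ℤ)) ∧ (0 < x 1 ∧ x 1 < (N : ℤ))) ∧
      (x 0 = 1 ∨ x 0 = (N : ℤ) - 1 ∨ x 1 = 1 ∨ x 1 = (N : ℤ) - 1) := by
  have ht0 : (0 : ℝ) < (N : ℝ)⁻¹ := inv_pos.2 (by exact_mod_cast hN)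
  have hD := meshDomain_oRect 0 1 0 1 ht0
  obtain ⟨hxD, y, hxy, hny⟩ := hx
  rw [hD] at hxD
  have hxV := (mem_meshVertices_unitSq hN).1 hxD
  refine ⟨hxV, ?_⟩
  have hyV : y ∉ meshVertices (oRect 0 1 0 1) (N : ℝ)⁻¹ := by
    intro hyV
    refine hny (discreteDomainGraph_adj_iff.2 ⟨meshGraph_adj_iff.2 ⟨hxy, ?_⟩, ?_, ?_⟩)
    · exact ((convex_rectangle _ _).segment_subset (left_mem_rectangle _ _)
        (right_mem_rectangle _ _)).trans ((rectangle_subset_oRect hxD hyV).trans subset_closure)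
    · rw [hD]; exact hxD
    · rw [hD]; exact hyV
  rw [mem_meshVertices_unitSq hN] at hyV
  rw [zdGraph_adj_iff] at hxy
  obtain ⟨i, h | h⟩ := hxy
  · have h0 := congrFun h 0
    have h1 := congrFun h 1
    fin_cases i <;> simp at h0 h1 <;> omega
  · have h0 := congrFun h 0
    have h1 := congrFun h 1
    fin_cases i <;> simp at h0 h1 <;> omega

/-- A mesh vertex of the unit square with a coordinate in `{1, N-1}` is a boundary vertex.
[folklore] -/
theorem mem_meshBoundary_unitSq {N : ℕ} (hN : 0 < N) {P : Site 2}
    (hP : (0 < P 0 ∧ P 0 < (N : ℤ)) ∧ (0 < P 1 ∧ P 1 < (N : ℤ)))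
    (hb : P 0 = 1 ∨ P 0 = (N : ℤ) - 1 ∨ P 1 = 1 ∨ P 1 = (N : ℤ) - 1) :
    P ∈ meshBoundary (oRect 0 1 0 1) (N : ℝ)⁻¹ := by
  have ht0 : (0 : ℝ) < (N : ℝ)⁻¹ := inv_pos.2 (by exact_mod_cast hN)
  have hD := meshDomain_oRect 0 1 0 1 ht0
  have hV : ∀ v : Site 2, v ∈ meshDomain (oRect 0 1 0 1) (N : ℝ)⁻¹ ↔
      (0 < v 0 ∧ v 0 < (N : ℤ)) ∧ (0 < v 1 ∧ v 1 < (N : ℤ)) := fun v => by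
    rw [hD, mem_meshVertices_unitSq hN]
  have out : ∀ (i : Fin 2) (s : ℤ), s = 1 ∨ s = -1 →
      ¬ ((0 < (P + Pi.single i s : Site 2) 0 ∧ (P + Pi.single i s : Site 2) 0 < (N : ℤ)) ∧
          (0 < (P + Pi.single i s : Site 2) 1 ∧ (P + Pi.single i s : Site 2) 1 < (N : ℤ))) →
      P ∈ meshBoundary (oRect 0 1 0 1) (N : ℝ)⁻¹ := fun i s hs h =>
    mem_meshBoundary_of_adj_not_mem ((hV P).2 hP) (zdGraph_adj_add_single P i hs)
      (fun hm => h ((hV _).1 hm))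
  rcases hb with h | h | h | h
  · exact out 0 (-1) (Or.inr rfl) (by simp; omega)
  · exact out 0 1 (Or.inl rfl) (by simp; omega)
  · exact out 1 (-1) (Or.inr rfl) (by simp; omega)
  · exact out 1 1 (Or.inl rfl) (by simp; omega)

/-- Points of the four closed sides are frontier points of the open unit square. [folklore] -/
theorem mem_frontier_unitSq {z : ℂ}
    (h : ((0 ≤ z.re ∧ z.re ≤ 1) ∧ (z.im = 0 ∨ z.im = 1)) ∨
      ((z.re = 0 ∨ z.re = 1) ∧ (0 ≤ z.im ∧ z.im ≤ 1))) :
    z ∈ frontier (oRect 0 1 0 1) := by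
  rw [oRect, frontier_reProdIm, closure_Ioo zero_ne_one, frontier_Ioo zero_lt_one]
  rcases h with ⟨hre, him⟩ | ⟨hre, him⟩
  · exact Or.inl ⟨hre, by rcases him with h | h <;> simp [h]⟩
  · exact Or.inr ⟨by rcases hre with h | h <;> simp [h], him⟩

/-- Lower bound for `infDist` to a nonempty set. [folklore] -/
theorem le_infDist_of_forall' {x : ℂ} {s : Set ℂ} {r : ℝ} (hs : s.Nonempty)
    (h : ∀ y ∈ s, r ≤ dist x y) : r ≤ infDist x s :=
  (le_infDist hs).2 fun _ hy => h _ hy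

/-- A point at sup-distance `≥ t` inside the unit square is at distance `≥ t` from its frontier
(frontier points lie on the four side lines). [folklore] -/
theorem le_dist_of_mem_frontier {t : ℝ} {p : ℂ} (h1 : t ≤ p.re) (h2 : p.re ≤ 1 - t)
    (h3 : t ≤ p.im) (h4 : p.im ≤ 1 - t) : ∀ z ∈ frontier (oRect 0 1 0 1), t ≤ dist p z := by
  intro z hz
  have hre : |p.re - z.re| ≤ dist p z := by rw [dist_eq_norm]; exact abs_re_sub_le_norm_sub p z
  have him : |p.im - z.im| ≤ dist p z := by rw [dist_eq_norm]; simpa using abs_im_le_norm (p - z)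
  rw [oRect, frontier_reProdIm, frontier_Ioo zero_lt_one] at hz
  simp only [mem_union, mem_reProdIm, mem_insert_iff, mem_singleton_iff] at hz
  rcases hz with ⟨-, h | h⟩ | ⟨h | h, -⟩
  · exact (le_abs.2 (Or.inl (by rw [h]; linarith))).trans him
  · exact (le_abs.2 (Or.inr (by rw [h]; linarith))).trans him
  · exact (le_abs.2 (Or.inl (by rw [h]; linarith))).trans hre
  · exact (le_abs.2 (Or.inr (by rw [h]; linarith))).trans hre

/-- Distance between two points on a vertical line. [folklore] -/
theorem dist_mk_of_re (a b c : ℝ) : dist (⟨a, b⟩ : ℂ) ⟨a, c⟩ = |b - c| := by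
  rw [dist_of_re_eq (z := ⟨a, b⟩) (w := ⟨a, c⟩) rfl, Real.dist_eq]

/-- Distance between two points on a horizontal line. [folklore] -/
theorem dist_mk_of_im (a b c : ℝ) : dist (⟨a, c⟩ : ℂ) ⟨b, c⟩ = |a - b| := by
  rw [dist_of_im_eq (z := ⟨a, c⟩) (w := ⟨b, c⟩) rfl, Real.dist_eq]

/-! ### The tie mechanism -/

/-- **Tie criterion.** At mesh `1/N` let `P = (i, j)` be a lattice vertex of the open unit square
with mesh point `(x, y)` at sup-distance `≥ 1/N` from the frontier and with a coordinate in
`{1, N-1}` (a boundary vertex). Then `P` lies in the discrete arc of EVERY boundary piece that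
comes within `1/N` of `(x, y)` and misses some frontier point (`discreteArc` compares with `≤`),
so any two such pieces `A`, `B` are `discreteCrossing`-joined for EVERY configuration `ω`, by the
trivial path at `P`. [folklore] -/
theorem tie_crossing {N : ℕ} (hN : 0 < N) {i j : ℤ} {x y : ℝ}
    (hx : (N : ℝ)⁻¹ * i = x) (hy : (N : ℝ)⁻¹ * j = y)
    (h1 : (N : ℝ)⁻¹ ≤ x) (h2 : x ≤ 1 - (N : ℝ)⁻¹) (h3 : (N : ℝ)⁻¹ ≤ y) (h4 : y ≤ 1 - (N : ℝ)⁻¹)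
    (hb : i = 1 ∨ i = (N : ℤ) - 1 ∨ j = 1 ∨ j = (N : ℤ) - 1)
    {A B : Set ℂ} {zA wA zB wB : ℂ}
    (hzA : zA ∈ A) (hdA : dist (⟨x, y⟩ : ℂ) zA ≤ (N : ℝ)⁻¹)
    (hwA : wA ∈ frontier (oRect 0 1 0 1)) (hwA' : wA ∉ A)
    (hzB : zB ∈ B) (hdB : dist (⟨x, y⟩ : ℂ) zB ≤ (N : ℝ)⁻¹)
    (hwB : wB ∈ frontier (oRect 0 1 0 1)) (hwB' : wB ∉ B)
    (ω : BondConfig (Site 2)) :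
    ω ∈ discreteCrossing (oRect 0 1 0 1) (N : ℝ)⁻¹ A B := by
  have ht0 : (0 : ℝ) < (N : ℝ)⁻¹ := inv_pos.2 (by exact_mod_cast hN)
  have hmp : meshPoint (N : ℝ)⁻¹ ![i, j] = ⟨x, y⟩ := by
    apply Complex.ext <;> simp [meshPoint_re, meshPoint_im, hx, hy]
  have hPV : (![i, j] : Site 2) ∈ meshVertices (oRect 0 1 0 1) (N : ℝ)⁻¹ := by
    rw [mem_meshVertices_iff, hmp]
    exact ⟨⟨by show (0 : ℝ) < x; linarith, by show x < 1; linarith⟩,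
      by show (0 : ℝ) < y; linarith, by show y < 1; linarith⟩
  have hbd : (![i, j] : Site 2) ∈ meshBoundary (oRect 0 1 0 1) (N : ℝ)⁻¹ :=
    mem_meshBoundary_unitSq hN ((mem_meshVertices_unitSq hN).1 hPV) (by simpa using hb)
  have hfar : ∀ C : Set ℂ, ∀ w ∈ frontier (oRect 0 1 0 1), w ∉ C →
      (N : ℝ)⁻¹ ≤ infDist (⟨x, y⟩ : ℂ) (frontier (oRect 0 1 0 1) \ C) := fun C w hw hwC =>
    le_infDist_of_forall' ⟨w, hw, hwC⟩ fun z hz =>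
      le_dist_of_mem_frontier (p := ⟨x, y⟩) h1 h2 h3 h4 z hz.1
  refine ⟨![i, j], ⟨hbd, ?_⟩, ![i, j], ⟨hbd, ?_⟩, SimpleGraph.Reachable.refl _⟩
  · rw [hmp]
    exact ((infDist_le_dist_of_mem hzA).trans hdA).trans (hfar A wA hwA hwA')
  · rw [hmp]
    exact ((infDist_le_dist_of_mem hzB).trans hdB).trans (hfar B wB hwB hwB')

/-! ### Towards T2: the truth is a long box crossing -/

/-- The support of a walk of `G ⊓ H` lies in any set containing the start and all `H`-neighbours.
[folklore] -/
theorem support_subset_of_walk {V : Type*} {G H : SimpleGraph V} {S : Set V}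
    (hH : ∀ a b, H.Adj a b → b ∈ S) {x y : V} (p : (G ⊓ H).Walk x y) (hx : x ∈ S) :
    ∀ z ∈ p.support, z ∈ S := by
  induction p with
  | nil => simpa using hx
  | cons h p ih => simpa [hx] using ih (hH _ _ ((SimpleGraph.inf_adj _ _ _ _).1 h).2)

/-- A vertex of the discrete arc of a vertical side `{re = s}` of the unit square is no farther
from it than from the bottom and from the top: `|x₀/N - s| ≤ x₁/N` and `|x₀/N - s| ≤ 1 - x₁/N`.
[folklore] -/
theorem arc_side_bounds {N : ℕ} {s : ℝ} {x : Site 2}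
    (hx : x ∈ discreteArc (oRect 0 1 0 1) (N : ℝ)⁻¹ {z : ℂ | z.re = s ∧ 0 ≤ z.im ∧ z.im ≤ 1})
    (hne : (N : ℝ)⁻¹ * x 0 ≠ s) :
    |(N : ℝ)⁻¹ * x 0 - s| ≤ (N : ℝ)⁻¹ * x 1 ∧ |(N : ℝ)⁻¹ * x 0 - s| ≤ 1 - (N : ℝ)⁻¹ * x 1 := by
  obtain ⟨hxB, hdist⟩ := hx
  obtain ⟨⟨h1, h2⟩, h3, h4⟩ :=
    mem_meshVertices_oRect.1 (meshDomain_subset_meshVertices _ _ hxB.1)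
  have hlow : |(N : ℝ)⁻¹ * x 0 - s| ≤
      infDist (meshPoint (N : ℝ)⁻¹ x) {z : ℂ | z.re = s ∧ 0 ≤ z.im ∧ z.im ≤ 1} :=
    le_infDist_of_forall' ⟨⟨s, 0⟩, rfl, le_rfl, zero_le_one⟩ fun z hz =>
      calc |(N : ℝ)⁻¹ * x 0 - s| = |(meshPoint (N : ℝ)⁻¹ x).re - z.re| := by
            rw [meshPoint_re, hz.1]
        _ ≤ ‖meshPoint (N : ℝ)⁻¹ x - z‖ := abs_re_sub_le_norm_sub _ _
        _ = dist _ z := (dist_eq_norm _ _).symm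
  have hF : ∀ t : ℝ, t = 0 ∨ t = 1 → (⟨(N : ℝ)⁻¹ * x 0, t⟩ : ℂ) ∈
      frontier (oRect 0 1 0 1) \ {z : ℂ | z.re = s ∧ 0 ≤ z.im ∧ z.im ≤ 1} := fun t ht =>
    ⟨mem_frontier_unitSq (Or.inl ⟨⟨h1.le, h2.le⟩, ht⟩), fun h => hne h.1⟩
  have hd : ∀ t : ℝ, dist (meshPoint (N : ℝ)⁻¹ x) ⟨(N : ℝ)⁻¹ * x 0, t⟩ = |(N : ℝ)⁻¹ * x 1 - t| :=
    fun t => by rw [dist_of_re_eq (by simp [meshPoint_re]), Real.dist_eq, meshPoint_im]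
  refine ⟨hlow.trans (hdist.trans ((infDist_le_dist_of_mem (hF 0 (Or.inl rfl))).trans_eq ?_)),
    hlow.trans (hdist.trans ((infDist_le_dist_of_mem (hF 1 (Or.inr rfl))).trans_eq ?_))⟩
  · rw [hd, sub_zero, abs_of_pos h3]
  · rw [hd, abs_sub_comm, abs_of_pos (by linarith)]

/-- **Truth forces a long box crossing.** At mesh `1/N`, `N ≥ 3`, an open crossing of the
discretised unit square from the discrete arc of its closed left side to that of its closed right
side is an open left-right crossing of the lattice square `(1,1) + [0, N-2]²`: by
`coord_of_mem_meshBoundary` and `arc_side_bounds` the two arcs are the columns `x₀ = 1`,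
`x₀ = N - 1`. [folklore] -/
theorem truth_subset {N : ℕ} (hN : 3 ≤ N) :
    discreteCrossing (oRect 0 1 0 1) (N : ℝ)⁻¹ {z : ℂ | z.re = 0 ∧ 0 ≤ z.im ∧ z.im ≤ 1}
        {z : ℂ | z.re = 1 ∧ 0 ≤ z.im ∧ z.im ≤ 1} ⊆ lrCrossingAt ![1, 1] (N - 2) (N - 2) := by
  rintro ω ⟨x, hx, y, hy, hr⟩
  have hN0 : 0 < N := by omega
  have hN' : (0 : ℝ) < N := by exact_mod_cast hN0
  have ht0 : (0 : ℝ) < (N : ℝ)⁻¹ := inv_pos.2 hN'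
  obtain ⟨⟨⟨hx0, hx0'⟩, hx1, hx1'⟩, hxb⟩ := coord_of_mem_meshBoundary hN0 hx.1
  obtain ⟨⟨⟨hy0, hy0'⟩, hy1, hy1'⟩, hyb⟩ := coord_of_mem_meshBoundary hN0 hy.1
  -- the left arc is the column `x₀ = 1`
  have hxcol : x 0 = 1 := by
    have hpos : (0 : ℝ) < (N : ℝ)⁻¹ * x 0 := mul_pos ht0 (by exact_mod_cast hx0)
    obtain ⟨ha, hb⟩ := arc_side_bounds hx hpos.ne'
    rw [sub_zero, abs_of_pos hpos] at ha hb
    have k1 : x 0 ≤ x 1 := by exact_mod_cast le_of_mul_le_mul_left ha ht0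
    have k2 : x 0 + x 1 ≤ (N : ℤ) := by
      have : (N : ℝ)⁻¹ * ((x 0 : ℝ) + x 1) ≤ (N : ℝ)⁻¹ * N := by
        rw [inv_mul_cancel₀ hN'.ne', mul_add]; linarith
      exact_mod_cast le_of_mul_le_mul_left this ht0
    omega
  -- the right arc is the column `x₀ = N - 1`
  have hycol : y 0 = (N : ℤ) - 1 := by
    have hlt : (N : ℝ)⁻¹ * y 0 < 1 := by
      have : ((y 0 : ℤ) : ℝ) < N := by exact_mod_cast hy0'
      rw [inv_mul_lt_iff₀ hN']; linarith
    obtain ⟨ha, hb⟩ := arc_side_bounds hy hlt.ne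
    rw [abs_sub_comm, abs_of_pos (sub_pos.2 hlt)] at ha hb
    have k1 : (N : ℤ) ≤ y 0 + y 1 := by
      have : (N : ℝ)⁻¹ * N ≤ (N : ℝ)⁻¹ * ((y 0 : ℝ) + y 1) := by
        rw [inv_mul_cancel₀ hN'.ne', mul_add]; linarith
      exact_mod_cast le_of_mul_le_mul_left this ht0
    have k2 : y 1 ≤ y 0 := by
      have : (N : ℝ)⁻¹ * ((y 1 : ℤ) : ℝ) ≤ (N : ℝ)⁻¹ * ((y 0 : ℤ) : ℝ) := by linarith
      exact_mod_cast le_of_mul_le_mul_left this ht0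
    omega
  -- the open path as an open connection inside the lattice square `(1,1) + [0,N-2]²`
  have hD := meshDomain_oRect 0 1 0 1 ht0
  obtain ⟨p⟩ := hr
  have hsupp : ∀ z ∈ p.support, z ∈ meshVertices (oRect 0 1 0 1) (N : ℝ)⁻¹ :=
    support_subset_of_walk (S := meshVertices (oRect 0 1 0 1) (N : ℝ)⁻¹)
      (fun a b hab => by rw [← hD]; exact (discreteDomainGraph_adj_iff.1 hab).2.2) p
      (meshDomain_subset_meshVertices _ _ hx.1.1)
  have hedges : ∀ e ∈ p.edges, e ∈ ω ∩ (zdGraph 2).edgeSet := fun e he => by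
    have h' := p.edges_subset_edgeSet he
    rw [SimpleGraph.edgeSet_inf] at h'
    exact ⟨edgeSet_openGraph_subset ω h'.1, SimpleGraph.edgeSet_mono
      ((discreteDomainGraph_le_meshGraph _ _).trans (meshGraph_le_zdGraph _ _)) h'.2⟩
  have hrect : meshVertices (oRect 0 1 0 1) (N : ℝ)⁻¹ ⊆
      (· + ![(1 : ℤ), 1]) '' (rectangle (N - 2) (N - 2) : Set (Site 2)) := fun v hv => by
    have h := (mem_meshVertices_unitSq hN0).1 hv
    rw [mem_image_rectangle_iff]
    simp only [Matrix.cons_val_zero, Matrix.cons_val_one]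
    omega
  have hconn := mem_openConnIn_of_walk p (fun z hz => hrect (hsupp z hz)) hedges
  refine isUpperSet_lrCrossingAt _ _ _ (inter_subset_left (s := ω) (t := (zdGraph 2).edgeSet))
    ⟨x, ⟨x - ![1, 1], ?_, sub_add_cancel _ _⟩, y, ⟨y - ![1, 1], ?_, sub_add_cancel _ _⟩, hconn⟩
  · simp only [Finset.mem_coe, leftSide, Finset.mem_filter, mem_rectangle_iff, Pi.sub_apply,
      Matrix.cons_val_zero, Matrix.cons_val_one]
    omega
  · simp only [Finset.mem_coe, rightSide, Finset.mem_filter, mem_rectangle_iff, Pi.sub_apply,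
      Matrix.cons_val_zero, Matrix.cons_val_one]
    omega


/-! ### The boundary segments at the commensurable mesh `1/(n k)` -/

/-- Bottom segments (coordinate position `t`): `im = 0`, `t/k ≤ re ≤ (t+1)/k`. [folklore] -/
theorem mem_seg0 {k : ℕ} {t : Fin k} {z : ℂ} : z ∈ seg 1 k ((0 : Fin 4), t) ↔
    z.im = 0 ∧ (t : ℝ) / k ≤ z.re ∧ z.re ≤ ((t : ℝ) + 1) / k := by
  simp [seg]

/-- Right segments: `re = 1`, `t/k ≤ im ≤ (t+1)/k`. [folklore] -/
theorem mem_seg1 {k : ℕ} {t : Fin k} {z : ℂ} : z ∈ seg 1 k ((1 : Fin 4), t) ↔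
    z.re = 1 ∧ (t : ℝ) / k ≤ z.im ∧ z.im ≤ ((t : ℝ) + 1) / k := by
  simp [seg]

/-- Top segments (coordinate position `t`, by `re`): `im = 1`, `t/k ≤ re ≤ (t+1)/k`. [folklore] -/
theorem mem_seg2 {k : ℕ} {t : Fin k} {z : ℂ} : z ∈ seg 1 k ((2 : Fin 4), t) ↔
    z.im = 1 ∧ (t : ℝ) / k ≤ z.re ∧ z.re ≤ ((t : ℝ) + 1) / k := by
  simp [seg]

/-- Left segments (coordinate position `t`, by `im`): `re = 0`, `t/k ≤ im ≤ (t+1)/k`. [folklore] -/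
theorem mem_seg3 {k : ℕ} {t : Fin k} {z : ℂ} : z ∈ seg 1 k ((3 : Fin 4), t) ↔
    z.re = 0 ∧ (t : ℝ) / k ≤ z.im ∧ z.im ≤ ((t : ℝ) + 1) / k := by
  simp [seg]

/-- Arithmetic of the commensurable mesh `1/N`, `N = n k` (`k ≥ 1`, `n ≥ 2`). [folklore] -/
theorem mesh_facts {k n N : ℕ} (hk : 1 ≤ k) (hn : 2 ≤ n) (hN : N = n * k) :
    (0 < N ∧ (0 : ℝ) < (N : ℝ)⁻¹ ∧ (N : ℝ)⁻¹ ≤ (k : ℝ)⁻¹ ∧ (N : ℝ)⁻¹ ≤ 1 - (N : ℝ)⁻¹) ∧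
    ((∀ t : ℕ, (N : ℝ)⁻¹ * (((n : ℤ) * t : ℤ) : ℝ) = (t : ℝ) / k) ∧
      (N : ℝ)⁻¹ * (((N : ℤ) - 1 : ℤ) : ℝ) = 1 - (N : ℝ)⁻¹) ∧
    ((∀ t : ℕ, 1 ≤ t → (k : ℝ)⁻¹ ≤ (t : ℝ) / k) ∧
      (∀ t : ℕ, t + 1 ≤ k → (t : ℝ) / k ≤ 1 - (k : ℝ)⁻¹) ∧
      ((k - 1 : ℕ) : ℝ) / k = 1 - (k : ℝ)⁻¹ ∧ (((k - 1 : ℕ) : ℝ) + 1) / k = 1) := by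
  have hN0 : 0 < N := by rw [hN]; exact Nat.mul_pos (by omega) hk
  have hN2 : (2 : ℝ) ≤ N := by
    have : 2 * 1 ≤ n * k := Nat.mul_le_mul hn hk
    rw [hN]; exact_mod_cast this
  have hk0 : (0 : ℝ) < k := by exact_mod_cast hk
  have hn0 : (0 : ℝ) < n := by exact_mod_cast (show 0 < n by omega)
  have hNr : (N : ℝ) = n * k := by rw [hN]; push_cast; ring
  have hN' : (0 : ℝ) < N := by exact_mod_cast hN0
  have ht0 : (0 : ℝ) < (N : ℝ)⁻¹ := inv_pos.2 hN'
  have hk1 : ((k - 1 : ℕ) : ℝ) = k - 1 := by rw [Nat.cast_sub hk, Nat.cast_one]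
  refine ⟨⟨hN0, ht0, inv_anti₀ hk0 ?_, ?_⟩, ⟨fun t => ?_, ?_⟩, fun t ht => ?_, fun t ht => ?_,
    ?_, ?_⟩
  · rw [hNr]; exact le_mul_of_one_le_left hk0.le (by exact_mod_cast (show 1 ≤ n by omega))
  · have : (N : ℝ)⁻¹ ≤ 1 / 2 := by rw [one_div]; exact inv_anti₀ two_pos hN2
    linarith
  · rw [hNr]; push_cast; field_simp
  · push_cast; rw [mul_sub, inv_mul_cancel₀ hN'.ne', mul_one]
  · rw [div_eq_mul_inv]
    exact le_mul_of_one_le_left (inv_pos.2 hk0).le (by exact_mod_cast ht)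
  · have : (t : ℝ) ≤ k - 1 := by
      have h' : ((t + 1 : ℕ) : ℝ) ≤ k := by exact_mod_cast ht
      push_cast at h'; linarith
    rw [div_le_iff₀ hk0, sub_mul, one_mul, inv_mul_cancel₀ hk0.ne']; exact this
  · rw [hk1, sub_div, div_self hk0.ne', one_div]
  · rw [hk1, sub_add_cancel, div_self hk0.ne']

section Steps

variable {k n N : ℕ}

/-- Same-side tie, bottom: consecutive bottom segments `t`, `t' = t + 1` are joined for every `ω`
(tie vertex `(n t', 1)` under the common endpoint `(t'/k, 0)`). [folklore] -/
theorem bottom_step (hk : 1 ≤ k) (hn : 2 ≤ n) (hN : N = n * k) {t t' : Fin k}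
    (ht : (t' : ℕ) = t + 1) (ω : BondConfig (Site 2)) :
    ω ∈ discreteCrossing (oRect 0 1 0 1) (N : ℝ)⁻¹ (seg 1 k (0, t)) (seg 1 k (0, t')) := by
  obtain ⟨⟨hN0, F1, F2, F7⟩, ⟨F3, -⟩, F5, F6, -⟩ := mesh_facts hk hn hN
  have htR : ((t' : ℕ) : ℝ) = (t : ℕ) + 1 := by exact_mod_cast ht
  have hlo : (N : ℝ)⁻¹ ≤ ((t' : ℕ) : ℝ) / k := F2.trans (F5 t' (by omega))
  have hhi : ((t' : ℕ) : ℝ) / k ≤ 1 - (N : ℝ)⁻¹ := (F6 t' (by omega)).trans (by linarith)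
  have hmem : ∀ s : Fin k, (s : ℕ) ≤ t' → (t' : ℕ) ≤ (s : ℕ) + 1 →
      (⟨((t' : ℕ) : ℝ) / k, 0⟩ : ℂ) ∈ seg 1 k (0, s) := fun s h h' =>
    mem_seg0.2 ⟨rfl, div_le_div_of_nonneg_right (by exact_mod_cast h) (Nat.cast_nonneg k),
      div_le_div_of_nonneg_right (by exact_mod_cast h') (Nat.cast_nonneg k)⟩
  have hd : dist (⟨((t' : ℕ) : ℝ) / k, (N : ℝ)⁻¹⟩ : ℂ) ⟨((t' : ℕ) : ℝ) / k, 0⟩ ≤ (N : ℝ)⁻¹ := by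
    rw [dist_mk_of_re, sub_zero, abs_of_pos F1]
  have hw : (⟨1 / 2, 1⟩ : ℂ) ∈ frontier (oRect 0 1 0 1) := mem_frontier_unitSq (by norm_num)
  exact tie_crossing hN0 (i := n * t') (j := 1) (F3 t') (by simp) hlo hhi le_rfl F7
    (Or.inr (Or.inr (Or.inl rfl))) (hmem t (by omega) (by omega)) hd hw (by simp [mem_seg0])
    (hmem t' le_rfl (by omega)) hd hw (by simp [mem_seg0]) ω

/-- Same-side tie, left: consecutive left segments are joined for every `ω` (tie vertex
`(1, n t')` beside the common endpoint `(0, t'/k)`). [folklore] -/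
theorem left_step (hk : 1 ≤ k) (hn : 2 ≤ n) (hN : N = n * k) {t t' : Fin k}
    (ht : (t' : ℕ) = t + 1) (ω : BondConfig (Site 2)) :
    ω ∈ discreteCrossing (oRect 0 1 0 1) (N : ℝ)⁻¹ (seg 1 k (3, t)) (seg 1 k (3, t')) := by
  obtain ⟨⟨hN0, F1, F2, F7⟩, ⟨F3, -⟩, F5, F6, -⟩ := mesh_facts hk hn hN
  have hlo : (N : ℝ)⁻¹ ≤ ((t' : ℕ) : ℝ) / k := F2.trans (F5 t' (by omega))
  have hhi : ((t' : ℕ) : ℝ) / k ≤ 1 - (N : ℝ)⁻¹ := (F6 t' (by omega)).trans (by linarith)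
  have hmem : ∀ s : Fin k, (s : ℕ) ≤ t' → (t' : ℕ) ≤ (s : ℕ) + 1 →
      (⟨0, ((t' : ℕ) : ℝ) / k⟩ : ℂ) ∈ seg 1 k (3, s) := fun s h h' =>
    mem_seg3.2 ⟨rfl, div_le_div_of_nonneg_right (by exact_mod_cast h) (Nat.cast_nonneg k),
      div_le_div_of_nonneg_right (by exact_mod_cast h') (Nat.cast_nonneg k)⟩
  have hd : dist (⟨(N : ℝ)⁻¹, ((t' : ℕ) : ℝ) / k⟩ : ℂ) ⟨0, ((t' : ℕ) : ℝ) / k⟩ ≤ (N : ℝ)⁻¹ := by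
    rw [dist_mk_of_im, sub_zero, abs_of_pos F1]
  have hw : (⟨1, 1 / 2⟩ : ℂ) ∈ frontier (oRect 0 1 0 1) := mem_frontier_unitSq (by norm_num)
  exact tie_crossing hN0 (i := 1) (j := n * t') (by simp) (F3 t') le_rfl F7 hlo hhi
    (Or.inl rfl) (hmem t (by omega) (by omega)) hd hw (by simp [mem_seg3])
    (hmem t' le_rfl (by omega)) hd hw (by simp [mem_seg3]) ω

/-- Same-side tie, right: consecutive right segments are joined for every `ω` (tie vertex
`(N-1, n t')`). [folklore] -/
theorem right_step (hk : 1 ≤ k) (hn : 2 ≤ n) (hN : N = n * k) {t t' : Fin k}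
    (ht : (t' : ℕ) = t + 1) (ω : BondConfig (Site 2)) :
    ω ∈ discreteCrossing (oRect 0 1 0 1) (N : ℝ)⁻¹ (seg 1 k (1, t)) (seg 1 k (1, t')) := by
  obtain ⟨⟨hN0, F1, F2, F7⟩, ⟨F3, F4⟩, F5, F6, -⟩ := mesh_facts hk hn hN
  have hlo : (N : ℝ)⁻¹ ≤ ((t' : ℕ) : ℝ) / k := F2.trans (F5 t' (by omega))
  have hhi : ((t' : ℕ) : ℝ) / k ≤ 1 - (N : ℝ)⁻¹ := (F6 t' (by omega)).trans (by linarith)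
  have hmem : ∀ s : Fin k, (s : ℕ) ≤ t' → (t' : ℕ) ≤ (s : ℕ) + 1 →
      (⟨1, ((t' : ℕ) : ℝ) / k⟩ : ℂ) ∈ seg 1 k (1, s) := fun s h h' =>
    mem_seg1.2 ⟨rfl, div_le_div_of_nonneg_right (by exact_mod_cast h) (Nat.cast_nonneg k),
      div_le_div_of_nonneg_right (by exact_mod_cast h') (Nat.cast_nonneg k)⟩
  have hd : dist (⟨1 - (N : ℝ)⁻¹, ((t' : ℕ) : ℝ) / k⟩ : ℂ) ⟨1, ((t' : ℕ) : ℝ) / k⟩ ≤ (N : ℝ)⁻¹ := by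
    rw [dist_mk_of_im, sub_sub_cancel_left, abs_neg, abs_of_pos F1]
  have hw : (⟨0, 1 / 2⟩ : ℂ) ∈ frontier (oRect 0 1 0 1) := mem_frontier_unitSq (by norm_num)
  exact tie_crossing hN0 (i := (N : ℤ) - 1) (j := n * t') F4 (F3 t') F7 le_rfl hlo hhi
    (Or.inr (Or.inl rfl)) (hmem t (by omega) (by omega)) hd hw (by simp [mem_seg1])
    (hmem t' le_rfl (by omega)) hd hw (by simp [mem_seg1]) ω

/-- Same-side tie, top: consecutive top segments are joined for every `ω` (tie vertex
`(n t', N-1)`). [folklore] -/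
theorem top_step (hk : 1 ≤ k) (hn : 2 ≤ n) (hN : N = n * k) {t t' : Fin k}
    (ht : (t' : ℕ) = t + 1) (ω : BondConfig (Site 2)) :
    ω ∈ discreteCrossing (oRect 0 1 0 1) (N : ℝ)⁻¹ (seg 1 k (2, t)) (seg 1 k (2, t')) := by
  obtain ⟨⟨hN0, F1, F2, F7⟩, ⟨F3, F4⟩, F5, F6, -⟩ := mesh_facts hk hn hN
  have hlo : (N : ℝ)⁻¹ ≤ ((t' : ℕ) : ℝ) / k := F2.trans (F5 t' (by omega))
  have hhi : ((t' : ℕ) : ℝ) / k ≤ 1 - (N : ℝ)⁻¹ := (F6 t' (by omega)).trans (by linarith)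
  have hmem : ∀ s : Fin k, (s : ℕ) ≤ t' → (t' : ℕ) ≤ (s : ℕ) + 1 →
      (⟨((t' : ℕ) : ℝ) / k, 1⟩ : ℂ) ∈ seg 1 k (2, s) := fun s h h' =>
    mem_seg2.2 ⟨rfl, div_le_div_of_nonneg_right (by exact_mod_cast h) (Nat.cast_nonneg k),
      div_le_div_of_nonneg_right (by exact_mod_cast h') (Nat.cast_nonneg k)⟩
  have hd : dist (⟨((t' : ℕ) : ℝ) / k, 1 - (N : ℝ)⁻¹⟩ : ℂ) ⟨((t' : ℕ) : ℝ) / k, 1⟩ ≤ (N : ℝ)⁻¹ := by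
    rw [dist_mk_of_re, sub_sub_cancel_left, abs_neg, abs_of_pos F1]
  have hw : (⟨1 / 2, 0⟩ : ℂ) ∈ frontier (oRect 0 1 0 1) := mem_frontier_unitSq (by norm_num)
  exact tie_crossing hN0 (i := n * t') (j := (N : ℤ) - 1) (F3 t') F4 hlo hhi F7 le_rfl
    (Or.inr (Or.inr (Or.inr rfl))) (hmem t (by omega) (by omega)) hd hw (by simp [mem_seg2])
    (hmem t' le_rfl (by omega)) hd hw (by simp [mem_seg2]) ω

/-- Corner tie, bottom-left: bottom segment `0` and left segment `0` are joined for every `ω`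
(tie vertex `(1, 1)`). [folklore] -/
theorem corner_bl (hk : 1 ≤ k) (hn : 2 ≤ n) (hN : N = n * k) (ω : BondConfig (Site 2)) :
    ω ∈ discreteCrossing (oRect 0 1 0 1) (N : ℝ)⁻¹ (seg 1 k (0, ⟨0, hk⟩))
      (seg 1 k (3, ⟨0, hk⟩)) := by
  obtain ⟨⟨hN0, F1, F2, F7⟩, -, -⟩ := mesh_facts hk hn hN
  have hdA : dist (⟨(N : ℝ)⁻¹, (N : ℝ)⁻¹⟩ : ℂ) ⟨(N : ℝ)⁻¹, 0⟩ ≤ (N : ℝ)⁻¹ := by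
    rw [dist_mk_of_re, sub_zero, abs_of_pos F1]
  have hdB : dist (⟨(N : ℝ)⁻¹, (N : ℝ)⁻¹⟩ : ℂ) ⟨0, (N : ℝ)⁻¹⟩ ≤ (N : ℝ)⁻¹ := by
    rw [dist_mk_of_im, sub_zero, abs_of_pos F1]
  refine tie_crossing hN0 (i := 1) (j := 1) (by simp) (by simp) le_rfl F7 le_rfl F7 (Or.inl rfl)
    (mem_seg0.2 ⟨rfl, by simp [F1.le], by simpa using F2⟩) hdA
    (mem_frontier_unitSq (z := ⟨1 / 2, 1⟩) (by norm_num)) (by simp [mem_seg0])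
    (mem_seg3.2 ⟨rfl, by simp [F1.le], by simpa using F2⟩) hdB
    (mem_frontier_unitSq (z := ⟨1, 1 / 2⟩) (by norm_num)) (by simp [mem_seg3]) ω

/-- Corner tie, bottom-right: bottom segment `k-1` and right segment `0` are joined for every `ω`
(tie vertex `(N-1, 1)`). [folklore] -/
theorem corner_br (hk : 1 ≤ k) (hn : 2 ≤ n) (hN : N = n * k) (ω : BondConfig (Site 2)) :
    ω ∈ discreteCrossing (oRect 0 1 0 1) (N : ℝ)⁻¹ (seg 1 k (0, ⟨k - 1, by omega⟩))
      (seg 1 k (1, ⟨0, hk⟩)) := by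
  obtain ⟨⟨hN0, F1, F2, F7⟩, ⟨-, F4⟩, -, -, F8, F9⟩ := mesh_facts hk hn hN
  have hdA : dist (⟨1 - (N : ℝ)⁻¹, (N : ℝ)⁻¹⟩ : ℂ) ⟨1 - (N : ℝ)⁻¹, 0⟩ ≤ (N : ℝ)⁻¹ := by
    rw [dist_mk_of_re, sub_zero, abs_of_pos F1]
  have hdB : dist (⟨1 - (N : ℝ)⁻¹, (N : ℝ)⁻¹⟩ : ℂ) ⟨1, (N : ℝ)⁻¹⟩ ≤ (N : ℝ)⁻¹ := by
    rw [dist_mk_of_im, sub_sub_cancel_left, abs_neg, abs_of_pos F1]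
  refine tie_crossing hN0 (i := (N : ℤ) - 1) (j := 1) F4 (by simp) F7 le_rfl le_rfl F7
    (Or.inr (Or.inl rfl))
    (mem_seg0.2 ⟨rfl, by simp only [F8]; linarith, by simp only [F9]; linarith⟩) hdA
    (mem_frontier_unitSq (z := ⟨1 / 2, 1⟩) (by norm_num)) (by simp [mem_seg0])
    (mem_seg1.2 ⟨rfl, by simp [F1.le], by simpa using F2⟩) hdB
    (mem_frontier_unitSq (z := ⟨0, 1 / 2⟩) (by norm_num)) (by simp [mem_seg1]) ω

/-- Corner tie, top-left: left segment `k-1` and top segment `0` are joined for every `ω`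
(tie vertex `(1, N-1)`). [folklore] -/
theorem corner_tl (hk : 1 ≤ k) (hn : 2 ≤ n) (hN : N = n * k) (ω : BondConfig (Site 2)) :
    ω ∈ discreteCrossing (oRect 0 1 0 1) (N : ℝ)⁻¹ (seg 1 k (3, ⟨k - 1, by omega⟩))
      (seg 1 k (2, ⟨0, hk⟩)) := by
  obtain ⟨⟨hN0, F1, F2, F7⟩, ⟨-, F4⟩, -, -, F8, F9⟩ := mesh_facts hk hn hN
  have hdA : dist (⟨(N : ℝ)⁻¹, 1 - (N : ℝ)⁻¹⟩ : ℂ) ⟨0, 1 - (N : ℝ)⁻¹⟩ ≤ (N : ℝ)⁻¹ := by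
    rw [dist_mk_of_im, sub_zero, abs_of_pos F1]
  have hdB : dist (⟨(N : ℝ)⁻¹, 1 - (N : ℝ)⁻¹⟩ : ℂ) ⟨(N : ℝ)⁻¹, 1⟩ ≤ (N : ℝ)⁻¹ := by
    rw [dist_mk_of_re, sub_sub_cancel_left, abs_neg, abs_of_pos F1]
  refine tie_crossing hN0 (i := 1) (j := (N : ℤ) - 1) (by simp) F4 le_rfl F7 F7 le_rfl
    (Or.inl rfl)
    (mem_seg3.2 ⟨rfl, by simp only [F8]; linarith, by simp only [F9]; linarith⟩) hdA
    (mem_frontier_unitSq (z := ⟨1, 1 / 2⟩) (by norm_num)) (by simp [mem_seg3])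
    (mem_seg2.2 ⟨rfl, by simp [F1.le], by simpa using F2⟩) hdB
    (mem_frontier_unitSq (z := ⟨1 / 2, 0⟩) (by norm_num)) (by simp [mem_seg2]) ω

end Steps

/-! ### T1: every read state is primal-connected -/

/-- Chaining consecutive ties along one side. [folklore] -/
theorem chain_side {k : ℕ} {R : Fin 4 × Fin k → Fin 4 × Fin k → Prop} (s : Fin 4) (hk : 1 ≤ k)
    (h : ∀ t t' : Fin k, (t' : ℕ) = t + 1 → R (s, t) (s, t')) :
    ∀ t : Fin k, Relation.EqvGen R (s, t) (s, ⟨0, hk⟩) := by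
  rintro ⟨v, hv⟩
  induction v with
  | zero => exact Relation.EqvGen.refl _
  | succ v ih =>
    exact Relation.EqvGen.trans _ _ _
      (Relation.EqvGen.symm _ _ (Relation.EqvGen.rel _ _ (h ⟨v, by omega⟩ ⟨v + 1, hv⟩ rfl)))
      (ih (by omega))

/-- At mesh `1/(n k)`, `n ≥ 2`, every two of the `4k` boundary segments (coordinate indexing) are
related by the equivalence closure of "joined by `discreteCrossing` in the unit square", for EVERY
configuration. [folklore] -/
theorem seg_all_related {k n N : ℕ} (hk : 1 ≤ k) (hn : 2 ≤ n) (hN : N = n * k)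
    (ω : BondConfig (Site 2)) (a b : Fin 4 × Fin k) :
    Relation.EqvGen (fun x y : Fin 4 × Fin k =>
      ω ∈ discreteCrossing (oRect 0 1 0 1) (N : ℝ)⁻¹ (seg 1 k x) (seg 1 k y)) a b := by
  set R : Fin 4 × Fin k → Fin 4 × Fin k → Prop := fun x y =>
    ω ∈ discreteCrossing (oRect 0 1 0 1) (N : ℝ)⁻¹ (seg 1 k x) (seg 1 k y) with hR
  have h0 : ∀ t : Fin k, Relation.EqvGen R (0, t) (0, ⟨0, hk⟩) :=
    chain_side 0 hk fun t t' h => bottom_step hk hn hN h ω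
  have h3 : ∀ t : Fin k, Relation.EqvGen R (3, t) (0, ⟨0, hk⟩) := fun t =>
    Relation.EqvGen.trans _ _ _ (chain_side 3 hk (fun t t' h => left_step hk hn hN h ω) t)
      (Relation.EqvGen.symm _ _ (Relation.EqvGen.rel _ _ (corner_bl hk hn hN ω)))
  have h1 : ∀ t : Fin k, Relation.EqvGen R (1, t) (0, ⟨0, hk⟩) := fun t =>
    Relation.EqvGen.trans _ _ _ (chain_side 1 hk (fun t t' h => right_step hk hn hN h ω) t)
      (Relation.EqvGen.trans _ _ _
        (Relation.EqvGen.symm _ _ (Relation.EqvGen.rel _ _ (corner_br hk hn hN ω))) (h0 _))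
  have h2 : ∀ t : Fin k, Relation.EqvGen R (2, t) (0, ⟨0, hk⟩) := fun t =>
    Relation.EqvGen.trans _ _ _ (chain_side 2 hk (fun t t' h => top_step hk hn hN h ω) t)
      (Relation.EqvGen.trans _ _ _
        (Relation.EqvGen.symm _ _ (Relation.EqvGen.rel _ _ (corner_tl hk hn hN ω))) (h3 _))
  have base : ∀ c : Fin 4 × Fin k, Relation.EqvGen R c (0, ⟨0, hk⟩) := by
    rintro ⟨s, t⟩
    fin_cases s
    · exact h0 t
    · exact h1 t
    · exact h2 t
    · exact h3 t
  exact Relation.EqvGen.trans _ _ _ (base a) (Relation.EqvGen.symm _ _ (base b))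

/-- **T1 — every read state is primal-connected.** For bond percolation on `ℤ²` read in the
window `sq 1 = (0,1)²` at resolution `k ≥ 1` and the commensurable mesh `u = 1/(n k)`, `n ≥ 2`,
any two boundary segments are related by the equivalence closure of the primal matrix of
`readZ k 1 u ω`, for EVERY configuration `ω` (adjacent segments share a tie vertex). [folklore] -/
theorem readZ_primal_eqvGen {k n N : ℕ} (hk : 1 ≤ k) (hn : 2 ≤ n) (hN : N = n * k)
    (ω : BondConfig (Site 2)) (a b : Fin 4 × Fin k) :
    Relation.EqvGen (fun x y => (readZ k 1 (N : ℝ)⁻¹ ω).primal x y = true) a b := by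
  have hiff : ∀ x y : Fin 4 × Fin k, (readZ k 1 (N : ℝ)⁻¹ ω).primal x y = true ↔
      ω ∈ discreteCrossing (oRect 0 1 0 1) (N : ℝ)⁻¹ (seg 1 k (toCoord x))
        (seg 1 k (toCoord y)) := by
    intro x y
    rw [primal_readZ_eq_true_iff, ccwSeg, ccwSeg, sq_one]
  rw [eqvGen_iff_of_equiv (Equiv.ofBijective toCoord toCoord_bijective)
    (r := fun x y : Fin 4 × Fin k =>
      ω ∈ discreteCrossing (oRect 0 1 0 1) (N : ℝ)⁻¹ (seg 1 k x) (seg 1 k y)) hiff]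
  exact seg_all_related hk hn hN ω _ _


/-! ### The Birth definitions mentioned by the stub (verbatim copies) -/

noncomputable section

open scoped BigOperators ENNReal

/-- Bond percolation on `ℤ²` at `p = 1/2` (the route's `PZ`). -/
abbrev PZ : Measure (BondConfig (Site 2)) := bondPercolation (zdGraph 2) half

/-- The open square window `(0, δ₀)²` (the route's `Sq`; also `Literature…sq`). -/
def Sq (δ₀ : ℝ) : Set ℂ := {z : ℂ | 0 < z.re ∧ z.re < δ₀ ∧ 0 < z.im ∧ z.im < δ₀}

/-- The route's dyadic boundary segment `seg δ₀ j a` (coordinate parametrisation), verbatim. -/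
def rseg (δ₀ : ℝ) (j : ℕ) (a : Fin 4 × Fin (2 ^ j)) : Set ℂ :=
  {z : ℂ | (a.1 = 0 ∧ z.im = 0 ∧ δ₀ * ((a.2 : ℕ) : ℝ) / 2 ^ j ≤ z.re ∧
      z.re ≤ δ₀ * (((a.2 : ℕ) : ℝ) + 1) / 2 ^ j) ∨
    (a.1 = 1 ∧ z.re = δ₀ ∧ δ₀ * ((a.2 : ℕ) : ℝ) / 2 ^ j ≤ z.im ∧
      z.im ≤ δ₀ * (((a.2 : ℕ) : ℝ) + 1) / 2 ^ j) ∨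
    (a.1 = 2 ∧ z.im = δ₀ ∧ δ₀ * ((a.2 : ℕ) : ℝ) / 2 ^ j ≤ z.re ∧
      z.re ≤ δ₀ * (((a.2 : ℕ) : ℝ) + 1) / 2 ^ j) ∨
    (a.1 = 3 ∧ z.re = 0 ∧ δ₀ * ((a.2 : ℕ) : ℝ) / 2 ^ j ≤ z.im ∧
      z.im ≤ δ₀ * (((a.2 : ℕ) : ℝ) + 1) / 2 ^ j)}

/-- The route's state cell `EZ δ₀ j u M` (bond-`ℤ²`, mesh `u`), verbatim. -/
def EZ (δ₀ : ℝ) (j : ℕ) (u : ℝ) (M : SegMatrix (2 ^ j)) : Set (BondConfig (Site 2)) :=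
  {ω | ∀ a b, ω ∈ discreteCrossing (Sq δ₀) u (rseg δ₀ j a) (rseg δ₀ j b) ↔ M a b = true}

/-- The bond-`ℤ²` reading vector at resolution `j` and mesh `u`: `M ↦ P_ℤ²(EZ M)`. -/
def zVec (δ₀ : ℝ) (j : ℕ) (u : ℝ) : SegMatrix (2 ^ j) → ℝ := fun M => PZ.real (EZ δ₀ j u M)

/-- **`Ψ_k`**: the planarity-corrected Langlands gluing RDE on laws of resolution-`k` square states,
`gluingRDE planarCoinGlue (uniform law on the 4k coins)`. -/
def Psi (k : ℕ) : PMF (BoxArcState k) → PMF (BoxArcState k) :=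
  gluingRDE (planarCoinGlue (k := k)) (PMF.uniformOfFintype (Fin 4 × Fin k → Bool))

/-- The primal matrix of a state in the ROUTE's coordinate indexing (`toCoord` converts the
counterclockwise positions of `BoxArcState` to the route's coordinate positions; it is an
involution). -/
def primalCoord {k : ℕ} (S : BoxArcState k) : SegMatrix k :=
  fun a b => S.primal (toCoord a) (toCoord b)

/-- Level-`j` coordinates of a law `μ` of resolution-`2^K` states: the real masses of the OR-fusion
`SegMatrix.coarsen K j` of its primal matrix (route indexing). -/
def lawVec (K j : ℕ) (μ : PMF (BoxArcState (2 ^ K))) : SegMatrix (2 ^ j) → ℝ :=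
  fun M => ((μ.map primalCoord).map (SegMatrix.coarsen K j) M).toReal

/-- The empty state (all entries `false`), used only as the value of a junk branch. -/
def emptyState (k : ℕ) : BoxArcState k := ⟨fun _ _ => false, fun _ _ => false⟩

open Classical in
/-- **The bond-`ℤ²` reading law** at resolution `k`, window `(0, δ₀)²`, mesh `u`: the law of
`readZ k δ₀ u` under `P_ℤ²`, i.e. `S ↦ P_ℤ²(stateEventZ k δ₀ u S)` (these masses always sum to `1`,
`hasSum_stateEventZ`; the `dite` only makes the definition total). -/
def lawZ (k : ℕ) (δ₀ u : ℝ) : PMF (BoxArcState k) :=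
  if h : HasSum (fun S => PZ (stateEventZ k δ₀ u S)) 1 then ⟨_, h⟩ else PMF.pure (emptyState k)

/-- **Glued `ℤ²` prediction**: `Ψ^m` applied to the `ℤ²` reading law at mesh `u`, top resolution
`2^K` (the model of `m` mesh-halvings of the square). -/
def predZ (K m : ℕ) (δ₀ u : ℝ) : PMF (BoxArcState (2 ^ K)) := (Psi (2 ^ K))^[m] (lawZ (2 ^ K) δ₀ u)

/-! ### The reading law is the law of `readZ` (copied from the skeleton) -/

/-- The Boolean indicator of a measurable predicate is measurable. [folklore] -/
theorem measurable_decide_pred {Ω : Type*} [MeasurableSpace Ω] {p : Ω → Prop} [DecidablePred p]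
    (hp : MeasurableSet {ω | p ω}) : Measurable fun ω => decide (p ω) := by
  refine measurable_to_countable' fun b => ?_
  cases b
  · have : (fun ω => decide (p ω)) ⁻¹' {false} = {ω | p ω}ᶜ := by
      ext ω; simp
    rw [this]; exact hp.compl
  · have : (fun ω => decide (p ω)) ⁻¹' {true} = {ω | p ω} := by
      ext ω; simp
    rw [this]; exact hp

/-- A map into `BoxArcState k` whose two matrix-valued components have measurable Boolean entries
is measurable (the σ-algebra on `BoxArcState k` is discrete, the state space finite). [folklore] -/
theorem measurable_boxArcState_mk {Ω : Type*} [MeasurableSpace Ω] {k : ℕ}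
    (P D : Ω → ArcRel k) (hP : ∀ a b, Measurable fun ω => P ω a b)
    (hD : ∀ a b, Measurable fun ω => D ω a b) :
    Measurable fun ω => (⟨P ω, D ω⟩ : BoxArcState k) := by
  have hG : Measurable fun ω => (P ω, D ω) :=
    (measurable_pi_lambda _ fun a => measurable_pi_lambda _ fun b => hP a b).prodMk
      (measurable_pi_lambda _ fun a => measurable_pi_lambda _ fun b => hD a b)
  refine measurable_to_countable' fun S => ?_
  have : (fun ω => (⟨P ω, D ω⟩ : BoxArcState k)) ⁻¹' {S} =
      (fun ω => (P ω, D ω)) ⁻¹' {(S.primal, S.dual)} := by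
    ext ω
    simp [BoxArcState.ext_iff]
  rw [this]
  exact hG (measurableSet_singleton _)

/-- `readZ k δ₀ u` is measurable (every mesh `u`). [folklore] -/
theorem measurable_readZ (k : ℕ) (δ₀ u : ℝ) : Measurable (readZ k δ₀ u) := by
  classical
  unfold readZ
  refine measurable_boxArcState_mk _ _ (fun a b => ?_) (fun a b => ?_)
  · exact measurable_decide_pred (measurableSet_discreteCrossing
      (Literature.Probability.Percolation.sq δ₀) u (ccwSeg δ₀ k a) (ccwSeg δ₀ k b))
  · exact measurable_decide_pred (measurable_dualConfig (measurableSet_discreteCrossing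
      (dualWindow u (Literature.Probability.Percolation.sq δ₀)) u
        (dualWindow u (ccwSeg δ₀ k a)) (dualWindow u (ccwSeg δ₀ k b))))

/-- The fibre masses of a measurable map into a finite discrete space sum to `1`. [folklore] -/
theorem hasSum_fibre {Ω S : Type*} [MeasurableSpace Ω] [MeasurableSpace S]
    [MeasurableSingletonClass S] [Fintype S] (μ : Measure Ω) [IsProbabilityMeasure μ] {f : Ω → S}
    (hf : Measurable f) : HasSum (fun s => μ (f ⁻¹' {s})) 1 := by
  have h := hasSum_fintype fun s => μ (f ⁻¹' {s})
  have htot : ∑ s, μ (f ⁻¹' {s}) = 1 := by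
    rw [← measure_biUnion_finset (fun s _ t _ hst => ?_) fun s _ => hf (measurableSet_singleton s)]
    · have : (⋃ s ∈ (Finset.univ : Finset S), f ⁻¹' {s}) = univ :=
        eq_univ_of_forall fun ω => mem_iUnion₂.2 ⟨f ω, Finset.mem_univ _, rfl⟩
      rw [this, measure_univ]
    · exact Set.disjoint_iff.2 fun ω ⟨h₁, h₂⟩ => hst ((mem_singleton_iff.1 h₁).symm.trans h₂)
  rwa [htot] at h

/-- The `ℤ²` state masses sum to `1` (every mesh). [folklore] -/
theorem hasSum_stateEventZ (k : ℕ) (δ₀ u : ℝ) :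
    HasSum (fun S => PZ (stateEventZ k δ₀ u S)) 1 :=
  hasSum_fibre PZ (measurable_readZ k δ₀ u)

/-- **`lawZ` is the reading law**: `lawZ k δ₀ u S = P_ℤ²(stateEventZ k δ₀ u S)`. [folklore] -/
theorem lawZ_apply (k : ℕ) (δ₀ u : ℝ) (S : BoxArcState k) :
    lawZ k δ₀ u S = PZ (stateEventZ k δ₀ u S) := by
  rw [lawZ, dif_pos (hasSum_stateEventZ k δ₀ u)]
  rfl

/-! ### T1 at law level, T2, and the level-`0` prediction mass -/

/-- States in the support of the reading law are read states. [folklore] -/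
theorem exists_readZ_of_mem_support {k : ℕ} {δ₀ u : ℝ} {S : BoxArcState k}
    (hS : S ∈ (lawZ k δ₀ u).support) : ∃ ω, readZ k δ₀ u ω = S := by
  rw [PMF.mem_support_iff, lawZ_apply] at hS
  obtain ⟨ω, hω⟩ := nonempty_of_measure_ne_zero hS
  exact ⟨ω, hω⟩

/-- **T1 at law level**: at the commensurable meshes `u = 1/(n k)`, `n ≥ 2`, every state in the
support of the `ℤ²` reading law `lawZ k 1 u` is primal-connected. [folklore] -/
theorem lawZ_support_eqvGen {k n N : ℕ} (hk : 1 ≤ k) (hn : 2 ≤ n) (hN : N = n * k) :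
    ∀ S ∈ (lawZ k 1 (N : ℝ)⁻¹).support, ∀ a b : Fin 4 × Fin k,
      Relation.EqvGen (fun x y => S.primal x y = true) a b := by
  intro S hS a b
  obtain ⟨ω, rfl⟩ := exists_readZ_of_mem_support hS
  exact readZ_primal_eqvGen hk hn hN ω a b

/-- The route's window at `δ₀ = 1` is the open unit square. [folklore] -/
theorem Sq_one : Sq 1 = oRect 0 1 0 1 := by
  ext z
  simp only [Sq, oRect, mem_reProdIm, mem_setOf_eq, mem_Ioo]
  tauto

/-- At level `0`, the route's segment `(3, 0)` is the closed left side of the unit square.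
[folklore] -/
theorem rseg_zero_left :
    rseg 1 0 ((3 : Fin 4), (0 : Fin (2 ^ 0))) = {z : ℂ | z.re = 0 ∧ 0 ≤ z.im ∧ z.im ≤ 1} := by
  ext z; simp [rseg]

/-- At level `0`, the route's segment `(1, 0)` is the closed right side of the unit square.
[folklore] -/
theorem rseg_zero_right :
    rseg 1 0 ((1 : Fin 4), (0 : Fin (2 ^ 0))) = {z : ℂ | z.re = 1 ∧ 0 ≤ z.im ∧ z.im ≤ 1} := by
  ext z; simp [rseg]

/-- **T2 — the truth is bounded away from `1`.** There is `c > 0` (RSW at aspect ratio `2`) such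
that at every mesh `1/N`, `N ≥ 5`, the level-`0` `ℤ²` reading mass of the all-joined matrix is
at most `1 - c`: the cell lies in the crossing "closed left side ↔ closed right side", i.e.
(`truth_subset`) in the long-way crossing `LR((1,1) + [0,N-2]²)`, whose probability is
`h(N-2, N-2) = 1 - h(N-1, N-3) ≤ 1 - h(2(N-3), N-3) ≤ 1 - c` (duality at `p = 1/2`,
`crossingProb_anti_left`, `HalfPlaneArm.crossingProb_ge_rsw`). [folklore] -/
theorem zVec_allTrue_le : ∃ c : ℝ, 0 < c ∧ ∀ N : ℕ, 5 ≤ N →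
    zVec 1 0 (N : ℝ)⁻¹ (fun _ _ => true) ≤ 1 - c := by
  obtain ⟨c, hc, hrsw⟩ := HalfPlaneArm.crossingProb_ge_rsw (k := 2) le_rfl
  refine ⟨c, hc, fun N hN => ?_⟩
  obtain ⟨L, rfl⟩ : ∃ L, N = L + 3 := ⟨N - 3, by omega⟩
  have hsub : EZ 1 0 ((L + 3 : ℕ) : ℝ)⁻¹ (fun _ _ => true) ⊆
      lrCrossingAt ![1, 1] (L + 1) (L + 1) := by
    intro ω hω
    have h := (hω ((3 : Fin 4), (0 : Fin (2 ^ 0))) ((1 : Fin 4), (0 : Fin (2 ^ 0)))).2 rfl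
    rw [Sq_one, rseg_zero_left, rseg_zero_right] at h
    have h' := truth_subset (N := L + 3) (by omega) h
    rwa [show L + 3 - 2 = L + 1 by omega] at h'
  have h1 : zVec 1 0 ((L + 3 : ℕ) : ℝ)⁻¹ (fun _ _ => true) ≤ crossingProb half (L + 1) (L + 1) := by
    rw [← bondPercolation_real_lrCrossingAt half ![1, 1] (L + 1) (L + 1)]
    exact measureReal_mono hsub
  have h2 : crossingProb half (L + 1) (L + 1) = 1 - crossingProb half (L + 1 + 1) L := by
    have h := crossingProb_add_real_dualTBCrossing_holds half (L + 1) (L + 1)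
    rw [real_dualTBCrossing_succ, symm_half] at h
    linarith
  have h3 : c ≤ crossingProb half (L + 1 + 1) L :=
    (hrsw L).trans (crossingProb_anti_left half (by omega) L)
  linarith

/-- The level-`0` coordinate of the all-joined matrix dominates the mass of the all-joined states
(coarsening an all-`true` matrix gives the all-`true` matrix). [folklore] -/
theorem toReal_allJoined_le_lawVec {K : ℕ} (μ : PMF (BoxArcState (2 ^ K))) :
    (μ.toOuterMeasure {S : BoxArcState (2 ^ K) | ∀ a b, S.primal a b = true}).toReal ≤
      lawVec K 0 μ (fun _ _ => true) := by
  unfold lawVec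
  rw [← PMF.toOuterMeasure_apply_singleton ((μ.map primalCoord).map (SegMatrix.coarsen K 0)),
    PMF.toOuterMeasure_map_apply, PMF.toOuterMeasure_map_apply]
  refine ENNReal.toReal_mono (ne_top_of_le_ne_top (measure_ne_top _ _)
    (μ.toOuterMeasure_apply_le_toMeasure_apply _)) (μ.toOuterMeasure_mono fun S hS => ?_)
  have hsub : ∀ i j : Fin (2 ^ 0), i = j := fun i j =>
    Fin.ext (by have := i.isLt; have := j.isLt; simp only [pow_zero] at *; omega)
  show SegMatrix.coarsen K 0 (primalCoord S) = fun _ _ => true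
  funext a b
  exact (SegMatrix.coarsen_apply_eq_true_iff K 0 _ a b).2
    ⟨⟨0, Nat.two_pow_pos K⟩, ⟨0, Nat.two_pow_pos K⟩, hsub _ _, hsub _ _, hS.1 _ _⟩

/-! ### The refutation -/

/-- **`stub_shadowingZ` is FALSE** (registered stub of the birth skeleton of crux
`CardyGluingRDE.GluingContraction`, stmt-CriticalPhenomena-8580): the `m`-fold glued prediction
`Ψ^m(lawZ)` does NOT shadow the true `ℤ²` law. Witness: `m = 1`,
`σ = 1`; given `C, κ` take `δ₀ = 1`, `K` large, `n = ⌈C⌉₊ + 3`, `u = 1/(n 2^K) ≤ δ₀/(C 2^K)`. At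
this commensurable mesh every read state is primal-connected (T1, tie vertices under the common
endpoints of adjacent segments, `discreteArc` compares with `≤`), so by the collapse lemma
`psiCollapse_allJoined_ge_real` the glued prediction puts mass `≥ 1 - 3·2^{-2^K}` on the
all-joined state, whence its level-`0` all-joined
coordinate is `≥ 1 - 3·2^{-2^K}`; the truth at mesh `u/2 = 1/(2N)` gives the all-joined level-`0`
matrix mass `≤ P(left ↔ right) ≤ 1 - c` (T2, RSW). Hence the level-`0` term alone of the
multiresolution sum is `≥ (c - 3·2^{-2^K})/2 ≥ c/4 > C·2^{-κK}`. [folklore] -/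
theorem stub_shadowingZ_false :
    ¬ (∀ m : ℕ, 1 ≤ m → ∀ σ : ℝ, 0 < σ → ∃ C κ : ℝ, 0 < C ∧ 0 < κ ∧
      ∀ δ₀ : ℝ, 0 < δ₀ → ∀ (K : ℕ) (u : ℝ), 0 < u → u ≤ δ₀ / (C * 2 ^ K) →
        multiResSum σ K (fun j => tvFin (zVec δ₀ j (u / 2 ^ m)) (lawVec K j (predZ K m δ₀ u)))
          ≤ C * (2 : ℝ) ^ (-(κ * (K : ℝ)))) := by
  intro H
  obtain ⟨C, κ, hC, hκ, H⟩ := H 1 le_rfl 1 one_pos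
  obtain ⟨c, hc, hcN⟩ := zVec_allTrue_le
  -- choice of the top resolution `K`: both slacks below `c/8`
  have hr1 : (2 : ℝ) ^ (-κ) < 1 := Real.rpow_lt_one_of_one_lt_of_neg one_lt_two (neg_neg_of_pos hκ)
  have hr0 : 0 ≤ (2 : ℝ) ^ (-κ) := Real.rpow_nonneg zero_le_two _
  obtain ⟨K₁, hK₁⟩ := exists_pow_lt_of_lt_one (show 0 < c / (8 * C) by positivity) hr1
  obtain ⟨K₂, hK₂⟩ := exists_pow_lt_of_lt_one (show 0 < c / 8 by positivity)
    (one_half_lt_one (α := ℝ))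
  set K := K₁ + K₂ with hKdef
  -- the commensurable mesh `u = 1/N`, `N = n 2^K`, `n = ⌈C⌉₊ + 3`
  set n := ⌈C⌉₊ + 3 with hndef
  set N := n * 2 ^ K with hNdef
  clear_value N
  have hk1 : 1 ≤ 2 ^ K := Nat.one_le_two_pow
  have hN3 : 3 ≤ N := by
    rw [hNdef]; exact le_trans (by norm_num) (Nat.mul_le_mul (show 3 ≤ n by omega) hk1)
  have hN0 : (0 : ℝ) < N := by exact_mod_cast (show 0 < N by omega)
  have hNr : (N : ℝ) = n * 2 ^ K := by rw [hNdef]; push_cast; ring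
  have hCn : C ≤ n := (Nat.le_ceil C).trans (by rw [hndef]; push_cast; linarith)
  have hu : (N : ℝ)⁻¹ ≤ 1 / (C * 2 ^ K) := by
    rw [one_div]
    refine inv_anti₀ (by positivity) ?_
    rw [hNr]
    exact mul_le_mul_of_nonneg_right hCn (by positivity)
  have key := H 1 one_pos K (N : ℝ)⁻¹ (inv_pos.2 hN0) hu
  -- level `0` of the multiresolution sum and its all-joined coordinate
  set d : ℕ → ℝ := fun j =>
    tvFin (zVec 1 j ((N : ℝ)⁻¹ / 2 ^ 1)) (lawVec K j (predZ K 1 1 (N : ℝ)⁻¹)) with hd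
  have hd0 : d 0 ≤ multiResSum 1 K d := by
    have := weight_mul_le_multiResSum (σ := 1) (d := d) (fun i => tvFin_nonneg _ _) (Nat.zero_le K)
    rwa [multiResWeight_zero, one_mul] at this
  have hgap : (1 / 2 : ℝ) * |zVec 1 0 ((N : ℝ)⁻¹ / 2 ^ 1) (fun _ _ => true) -
      lawVec K 0 (predZ K 1 1 (N : ℝ)⁻¹) (fun _ _ => true)| ≤ d 0 :=
    mul_le_mul_of_nonneg_left (Finset.single_le_sum
      (f := fun M => |zVec 1 0 ((N : ℝ)⁻¹ / 2 ^ 1) M - lawVec K 0 (predZ K 1 1 (N : ℝ)⁻¹) M|)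
      (fun M _ => abs_nonneg _) (Finset.mem_univ _)) (by norm_num)
  -- T2: the truth at mesh `u/2 = 1/(2N)`
  have hz : zVec 1 0 ((N : ℝ)⁻¹ / 2 ^ 1) (fun _ _ => true) ≤ 1 - c := by
    have : (N : ℝ)⁻¹ / 2 ^ 1 = ((2 * N : ℕ) : ℝ)⁻¹ := by
      rw [Nat.cast_mul, Nat.cast_ofNat, mul_inv_rev, pow_one, div_eq_mul_inv]
    rw [this]
    exact hcN (2 * N) (by omega)
  -- T1 + collapse: the prediction
  have hl : 1 - 3 * (2 : ℝ)⁻¹ ^ (2 ^ K) ≤ lawVec K 0 (predZ K 1 1 (N : ℝ)⁻¹) (fun _ _ => true) :=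
    (psiCollapse_allJoined_ge_real (2 ^ K) _ (lawZ_support_eqvGen hk1 (by omega) hNdef)
      subset_rfl).trans (toReal_allJoined_le_lawVec _)
  -- the two slacks
  have hs1 : 3 * (2 : ℝ)⁻¹ ^ (2 ^ K) ≤ c / 2 := by
    have : (2 : ℝ)⁻¹ ^ (2 ^ K) ≤ (1 / 2 : ℝ) ^ K₂ := by
      rw [one_div]
      exact pow_le_pow_of_le_one (by norm_num) (by norm_num)
        ((Nat.le_add_left K₂ K₁).trans Nat.lt_two_pow_self.le)
    linarith
  have hs2 : C * (2 : ℝ) ^ (-(κ * (K : ℝ))) < c / 8 := by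
    rw [← neg_mul, Real.rpow_mul (by norm_num), Real.rpow_natCast]
    calc C * ((2 : ℝ) ^ (-κ)) ^ K ≤ C * ((2 : ℝ) ^ (-κ)) ^ K₁ :=
          mul_le_mul_of_nonneg_left (pow_le_pow_of_le_one hr0 hr1.le (Nat.le_add_right K₁ K₂)) hC.le
      _ < C * (c / (8 * C)) := mul_lt_mul_of_pos_left hK₁ hC
      _ = c / 8 := by field_simp
  have habs := le_abs_self (lawVec K 0 (predZ K 1 1 (N : ℝ)⁻¹) (fun _ _ => true) -
      zVec 1 0 ((N : ℝ)⁻¹ / 2 ^ 1) (fun _ _ => true))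
  rw [abs_sub_comm] at habs
  linarith

end

end StubShadowingZ

end Summit.CriticalPhenomena.CardyFormulaZ2.Theorems
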